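import Literature.Analysis.FunctionSpaces.TorusPeriodizationCube
import Literature.Analysis.FunctionSpaces.FlatTorusProofs
import Mathlib.MeasureTheory.Measure.Haar.NormedSpace
import Mathlib.Analysis.InnerProductSpace.Laplacian
import HarnessLib

/-!
# Functions on `ℝ³`, periodic in the vertical variable, read on the flat torus `T³`

Analysis/FunctionSpaces support file (theorem-only; notion `flat_torus_T3`). The dictionary used
to read a function on `ℝ³` which is `1`-periodic in the vertical variable `y₂` and supported,
horizontally, inside the open unit square, as the function `ξ ↦ G (repr ξ)` on the torus
`T³ = UnitAddTorus (Fin 3)` (Grafakos, *Classical Fourier Analysis*, §3.1.1: functions on `Tⁿ` as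
periodic functions on `ℝⁿ`; here only one direction is genuinely periodic and the other two are
periodised trivially because of the compact horizontal support) — the device by which the interior
regularity of the weak Neumann potential on the periodic cylinder is reduced to Weyl's lemma on the
torus (`TorusWeaklyHarmonic`, consumer `FluidPDE/PeriodicCylinderNeumann*`):

* `Torus.repr_proj_apply` — `repr (proj y)ᵢ = fract yᵢ`;
* `Torus.contDiff_comp_repr_proj`, `Torus.isSmooth_comp_repr` — **the lift `y ↦ G (repr (proj y))`
  is smooth** (so `ξ ↦ G (repr ξ)` is `Torus.IsSmooth`) when `G` is smooth, `1`-periodic in `y₂`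
  and vanishes for `y₀ ∉ (δ, 1−δ)` or `y₁ ∉ (δ, 1−δ)`: near points whose horizontal fractional parts
  are away from `0, 1` the lift is a translate of `G` (floors locally constant), near the others it
  vanishes identically;
* `Torus.integral_comp_repr` — `∫_{T³} h (repr ξ) dξ = ∫_{[0,1)³} h` (tree
  `Torus.integral_eq_integral_lift_holds`, `repr ∘ proj = id` on the cube);
  `Torus.integrable_comp_repr` (from `Torus.measurePreserving_repr`);
  `Torus.ae_restrict_unitCube_of_ae_comp_repr` — a.e. statements transfer from the torus to the cube;
* affine rescalings `y ↦ A y + v₀` of `ℝ³`: `setIntegral_comp_affine`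
  (`∫_Q H(Ay+v₀) dy = (A³)⁻¹ ∫_{AQ+v₀} H`, Mathlib `Measure.setIntegral_comp_smul_of_pos` and the
  measure-preserving translation), `fderiv_comp_smul_add_apply`, `fderiv_fderiv_comp_smul_add_apply`,
  `laplacian_comp_affine` (`Δ(Φ(A·+v₀)) = A² (ΔΦ)(A·+v₀)`, Mathlib's Laplacian through
  `laplacian_eq_iteratedFDeriv_orthonormalBasis` and `iteratedFDeriv_two_apply`).

## Mathlib / tree search

Tree: `Torus.periodize`/`perSum` (`TorusPeriodization*`) periodise functions with compact support
in all directions (`isSmooth_periodize` needs `tsupport g ⊆ closedBall 0 R`), not functions that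
are already periodic in one variable; `Torus.measurePreserving_repr`,
`Torus.integral_eq_integral_lift_holds`, `Torus.repr_proj_of_mem_unitCube_holds` (`FlatTorusProofs`).
Mathlib: `AddCircle.coe_equivIco_mk_apply`, `Function.Periodic.int_mul`, `Int.floor_eq_iff`,
`MeasurePreserving.integrable_comp`, `Measure.setIntegral_comp_smul_of_pos`,
`MeasurePreserving.setIntegral_image_emb`.

## References

* L. Grafakos, *Classical Fourier Analysis*, 3rd ed. (2014), §3.1.1. [Grafakos2014]
-/

noncomputable section

open MeasureTheory Set Function Filter Topology Metric
open scoped ContDiff Pointwise Laplacian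

namespace Literature.Analysis.FunctionSpaces

namespace Torus

/-- Local notation for `ℝ³ = EuclideanSpace ℝ (Fin 3)`. -/
local notation "E3" => EuclideanSpace ℝ (Fin 3)

variable {F : Type*} [NormedAddCommGroup F] [NormedSpace ℝ F]

/-! ### The representative of `proj y` is the fractional part -/

/-- The coordinates of `repr (proj y)` are the fractional parts of those of `y`. [folklore] -/
theorem repr_proj_apply (y : E3) (i : Fin 3) : repr (proj y) i = Int.fract (y i) := by
  rw [repr_apply, proj_apply]
  have h := AddCircle.coe_equivIco_mk_apply (p := (1 : ℝ)) (y i)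
  simp only [div_one, mul_one] at h
  exact h

/-- `repr (proj y)` written with fractional parts. [folklore] -/
theorem repr_proj_eq (y : E3) : repr (proj y) = WithLp.toLp 2 fun i => Int.fract (y i) := by
  ext i; simp [repr_proj_apply]

/-! ### Smoothness of the lift of a vertically periodic, horizontally compactly supported function -/

omit [NormedAddCommGroup F] [NormedSpace ℝ F] in
/-- A function on `ℝ³` which is `1`-periodic in the vertical variable is invariant under vertical
integer shifts. [folklore] -/
theorem periodic_vertical_int {G : E3 → F} (hz : ∀ y : E3, G (y + EuclideanSpace.single 2 1) = G y)
    (n : ℤ) (y : E3) : G (y + (n : ℝ) • EuclideanSpace.single 2 (1 : ℝ)) = G y := by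
  have hper : Function.Periodic (fun t : ℝ => G (y + t • EuclideanSpace.single 2 (1 : ℝ))) 1 := fun t => by
    simp only [add_smul, one_smul, ← add_assoc, hz]
  have h := hper.int_mul n 0
  simp only [zero_add, zero_smul, add_zero, mul_one] at h
  exact h

/-- **The lift to `ℝ³` of `ξ ↦ G (repr ξ)` is smooth** when `G` is smooth, `1`-periodic in the
vertical variable and vanishes near the vertical faces of the unit cube (`G y = 0` whenever
`y₀ ∉ (δ, 1 − δ)` or `y₁ ∉ (δ, 1 − δ)`): near a point whose horizontal fractional parts are away
from `0, 1` the lift is a translate of `G`; near the other points it vanishes identically. [folklore] -/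
theorem contDiff_comp_repr_proj {G : E3 → F} (hG : ContDiff ℝ ∞ G)
    (hz : ∀ y : E3, G (y + EuclideanSpace.single 2 1) = G y) {δ : ℝ} (hδ : 0 < δ)
    (h0 : ∀ y : E3, (y 0 ≤ δ ∨ 1 - δ ≤ y 0 ∨ y 1 ≤ δ ∨ 1 - δ ≤ y 1) → G y = 0) :
    ContDiff ℝ ∞ fun y : E3 => G (repr (proj y)) := by
  -- the lift with fractional parts, vertical coordinate not reduced
  set P : E3 → E3 := fun y => WithLp.toLp 2 ![Int.fract (y 0), Int.fract (y 1), y 2] with hP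
  have hP0 : ∀ y, P y 0 = Int.fract (y 0) := fun y => by simp [hP]
  have hP1 : ∀ y, P y 1 = Int.fract (y 1) := fun y => by simp [hP]
  have hP2 : ∀ y, P y 2 = y 2 := fun y => by simp [hP]
  have hPeq : ∀ y, G (repr (proj y)) = G (P y) := fun y => by
    have h := periodic_vertical_int hz (⌊y 2⌋) (repr (proj y))
    rw [← h]
    congr 1
    ext i
    fin_cases i <;> simp [repr_proj_apply, hP, Int.fract_add_floor]
  simp_rw [hPeq]
  refine contDiff_iff_contDiffAt.2 fun y₀ => ?_
  have hcoord : ∀ i : Fin 3, Continuous fun y : E3 => y i := fun i => (continuous_apply i).comp (PiLp.continuous_ofLp 2 _)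
  -- the horizontal coordinates near `y₀`
  have hnear : ∀ i : Fin 3, ∀ᶠ y in 𝓝 y₀, |y i - y₀ i| < δ / 2 := fun i =>
    ((hcoord i).continuousAt.eventually (Metric.ball_mem_nhds (y₀ i) (half_pos hδ))).mono fun y hy => by
      simpa [Real.dist_eq] using hy
  by_cases hgood : (δ / 2 < Int.fract (y₀ 0) ∧ Int.fract (y₀ 0) < 1 - δ / 2) ∧
      (δ / 2 < Int.fract (y₀ 1) ∧ Int.fract (y₀ 1) < 1 - δ / 2)
  · -- near `y₀` the floors of the horizontal coordinates are constant
    have hfl : ∀ i : Fin 3, (δ / 2 < Int.fract (y₀ i) ∧ Int.fract (y₀ i) < 1 - δ / 2) →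
        ∀ᶠ y in 𝓝 y₀, (⌊y i⌋ : ℝ) = ⌊y₀ i⌋ := fun i hi => by
      filter_upwards [hnear i] with y hy
      have hab := abs_lt.1 hy
      have hf0 := Int.floor_le (y₀ i)
      have hf1 := Int.lt_floor_add_one (y₀ i)
      rw [Int.fract] at hi
      have : ⌊y i⌋ = ⌊y₀ i⌋ := Int.floor_eq_iff.2 ⟨by push_cast; linarith, by push_cast; linarith⟩
      exact_mod_cast this
    set c : E3 := WithLp.toLp 2 ![(⌊y₀ 0⌋ : ℝ), (⌊y₀ 1⌋ : ℝ), 0] with hc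
    have hloc : ∀ᶠ y in 𝓝 y₀, P y = y - c := by
      filter_upwards [hfl 0 hgood.1, hfl 1 hgood.2] with y hy0 hy1
      ext i
      fin_cases i
      · show P y 0 = y 0 - c 0
        rw [hP0, Int.fract, hy0]; simp [hc]
      · show P y 1 = y 1 - c 1
        rw [hP1, Int.fract, hy1]; simp [hc]
      · show P y 2 = y 2 - c 2
        rw [hP2]; simp [hc]
    have hsm : ContDiffAt ℝ ∞ (fun y => G (y - c)) y₀ := (hG.comp (contDiff_id.sub contDiff_const)).contDiffAt
    exact hsm.congr_of_eventuallyEq (hloc.mono fun y hy => by simp only [hy])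
  · -- near `y₀` the lift vanishes
    -- key estimate: if `fract y₀ᵢ` is within `δ/2` of `0` or `1` and `|yᵢ − y₀ᵢ| < δ/2`, then
    -- `fract yᵢ ≤ δ` or `fract yᵢ ≥ 1 − δ`
    have key : ∀ i : Fin 3, (Int.fract (y₀ i) ≤ δ / 2 ∨ 1 - δ / 2 ≤ Int.fract (y₀ i)) →
        ∀ᶠ y in 𝓝 y₀, Int.fract (y i) ≤ δ ∨ 1 - δ ≤ Int.fract (y i) := fun i hi => by
      filter_upwards [hnear i] with y hy
      have hab := abs_lt.1 hy
      by_contra hcon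
      rw [not_or, not_le, not_le] at hcon
      -- then `fract yᵢ ∈ (δ, 1 − δ)`, so `⌊y₀ i⌋ = ⌊y i⌋` and the fractional parts differ by `< δ/2`
      have hy0 := Int.floor_le (y i)
      have hy1 := Int.lt_floor_add_one (y i)
      have hfy : Int.fract (y i) = y i - ⌊y i⌋ := rfl
      rw [hfy] at hcon
      have hfl : ⌊y₀ i⌋ = ⌊y i⌋ := Int.floor_eq_iff.2 ⟨by push_cast; linarith, by push_cast; linarith⟩
      have hfy0 : Int.fract (y₀ i) = y₀ i - ⌊y i⌋ := by rw [Int.fract, hfl]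
      rw [hfy0] at hi
      rcases hi with hi | hi <;> linarith
    have hzero : ∀ᶠ y in 𝓝 y₀, G (P y) = 0 := by
      simp only [not_and_or, not_lt] at hgood
      rcases hgood with h | h
      · filter_upwards [key 0 (by rcases h with h | h <;> [left; right] <;> linarith)] with y hy
        refine h0 _ ?_
        rw [hP0, hP1]
        rcases hy with hy | hy
        · exact Or.inl hy
        · exact Or.inr (Or.inl hy)
      · filter_upwards [key 1 (by rcases h with h | h <;> [left; right] <;> linarith)] with y hy
        refine h0 _ ?_
        rw [hP0, hP1]
        rcases hy with hy | hy
        · exact Or.inr (Or.inr (Or.inl hy))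
        · exact Or.inr (Or.inr (Or.inr hy))
    exact (contDiffAt_const (c := (0 : F))).congr_of_eventuallyEq hzero

/-- Torus form: `ξ ↦ G (repr ξ)` is smooth on `T³` under the same hypotheses. [folklore] -/
theorem isSmooth_comp_repr {G : E3 → F} (hG : ContDiff ℝ ∞ G)
    (hz : ∀ y : E3, G (y + EuclideanSpace.single 2 1) = G y) {δ : ℝ} (hδ : 0 < δ)
    (h0 : ∀ y : E3, (y 0 ≤ δ ∨ 1 - δ ≤ y 0 ∨ y 1 ≤ δ ∨ 1 - δ ≤ y 1) → G y = 0) :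
    IsSmooth (fun ξ : UnitAddTorus (Fin 3) => G (repr ξ)) := by
  show ContDiff ℝ ∞ (lift fun ξ : UnitAddTorus (Fin 3) => G (repr ξ))
  exact contDiff_comp_repr_proj hG hz hδ h0

/-! ### Integrals of functions of the representative -/

/-- **Torus integrals of functions of the representative are cube integrals**:
`∫_{T³} h(repr ξ) dξ = ∫_{[0,1)³} h`. [folklore] -/
theorem integral_comp_repr {d : Type*} [Fintype d] [DecidableEq d] (h : EuclideanSpace ℝ d → F) :
    ∫ ξ : UnitAddTorus d, h (repr ξ) = ∫ y in unitCube d, h y := by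
  rw [integral_eq_integral_lift_holds]
  refine setIntegral_congr_fun measurableSet_unitCube fun y hy => ?_
  simp only [lift_apply, repr_proj_of_mem_unitCube_holds hy]

omit [NormedSpace ℝ F] in
/-- **Integrability of a function of the representative** from integrability on the cube.
[folklore] -/
theorem integrable_comp_repr {d : Type*} [Fintype d] [DecidableEq d] {h : EuclideanSpace ℝ d → F}
    (hh : IntegrableOn h (unitCube d) volume) : Integrable (fun ξ : UnitAddTorus d => h (repr ξ)) volume :=
  (measurePreserving_repr.integrable_comp hh.aestronglyMeasurable).2 hh

/-- Transfer of an a.e. statement from the torus to the cube. [folklore] -/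
theorem ae_restrict_unitCube_of_ae_comp_repr {d : Type*} [Fintype d] [DecidableEq d] {p : EuclideanSpace ℝ d → Prop}
    (hp : MeasurableSet {y | p y}) (h : ∀ᵐ ξ : UnitAddTorus d, p (repr ξ)) :
    ∀ᵐ y ∂(volume.restrict (unitCube d)), p y := by
  rw [ae_iff] at h ⊢
  have hmp := (measurePreserving_repr (d := d)).measure_preimage (s := {y | ¬ p y}) hp.compl.nullMeasurableSet
  rw [← hmp]
  exact h

end Torus

section Affine

/-- Local notation for `ℝ³ = EuclideanSpace ℝ (Fin 3)`. -/
local notation "E3" => EuclideanSpace ℝ (Fin 3)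

variable {F : Type*} [NormedAddCommGroup F] [NormedSpace ℝ F]

/-! ### Affine rescaling of `ℝ³` -/

/-- **Change of variables in an affine rescaling**: `∫_Q H(A y + v₀) dy = (A³)⁻¹ ∫_{A Q + v₀} H`.
[folklore] -/
theorem setIntegral_comp_affine (H : E3 → F) {A : ℝ} (hA : 0 < A) (v₀ : E3) (Q : Set E3) :
    ∫ y in Q, H (A • y + v₀) = (A ^ 3)⁻¹ • ∫ x in (fun x => x + v₀) '' (A • Q), H x := by
  have h1 := Measure.setIntegral_comp_smul_of_pos (μ := (volume : Measure E3)) (fun z => H (z + v₀)) Q hA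
  simp only [finrank_euclideanSpace_fin] at h1
  rw [h1]
  congr 1
  have hmp : MeasurePreserving (fun x : E3 => x + v₀) volume volume := measurePreserving_add_right volume _
  have hemb : MeasurableEmbedding (fun x : E3 => x + v₀) := (Homeomorph.addRight v₀).measurableEmbedding
  exact (hmp.setIntegral_image_emb hemb H (A • Q)).symm

/-- The derivative of a function composed with an affine rescaling. [folklore] -/
theorem fderiv_comp_smul_add_apply {Φ : E3 → F} (hΦ : Differentiable ℝ Φ) (A : ℝ) (v₀ y v : E3) :
    fderiv ℝ (fun y => Φ (A • y + v₀)) y v = A • fderiv ℝ Φ (A • y + v₀) v := by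
  have hS : HasFDerivAt (fun y : E3 => A • y + v₀) (A • ContinuousLinearMap.id ℝ E3) y := by
    simpa using ((ContinuousLinearMap.id ℝ E3).hasFDerivAt.const_smul A).add_const v₀
  have h : HasFDerivAt (fun y => Φ (A • y + v₀)) ((fderiv ℝ Φ (A • y + v₀)).comp (A • ContinuousLinearMap.id ℝ E3)) y :=
    (hΦ (A • y + v₀)).hasFDerivAt.comp y hS
  rw [h.fderiv]
  simp

/-- The second derivative along `b` of a function composed with an affine rescaling. [folklore] -/
theorem fderiv_fderiv_comp_smul_add_apply {Φ : E3 → F} (hΦ : ContDiff ℝ 2 Φ) (A : ℝ) (v₀ y b : E3) :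
    fderiv ℝ (fun y => fderiv ℝ (fun y => Φ (A • y + v₀)) y b) y b =
      A ^ 2 • fderiv ℝ (fun z => fderiv ℝ Φ z b) (A • y + v₀) b := by
  have hd : Differentiable ℝ Φ := hΦ.differentiable (by norm_num)
  have hd2 : Differentiable ℝ (fun z => fderiv ℝ Φ z b) :=
    ((hΦ.fderiv_right (m := 1) (by norm_num)).differentiable one_ne_zero).clm_apply (differentiable_const b)
  have h1 : (fun y => fderiv ℝ (fun y => Φ (A • y + v₀)) y b) = fun y => A • (fun z => fderiv ℝ Φ z b) (A • y + v₀) :=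
    funext fun y => fderiv_comp_smul_add_apply hd A v₀ y b
  have hdc : DifferentiableAt ℝ (fun y : E3 => (fun z => fderiv ℝ Φ z b) (A • y + v₀)) y :=
    (hd2 _).comp y (((differentiable_id.const_smul A).add (differentiable_const v₀)) y)
  rw [h1, fderiv_fun_const_smul hdc A, _root_.FunLike.coe_smul, Pi.smul_apply, fderiv_comp_smul_add_apply hd2 A v₀ y b, smul_smul, pow_two]

/-- **The Laplacian of a function composed with an affine rescaling**:
`Δ(Φ(A· + v₀))(y) = A² ΔΦ(A y + v₀)`. [folklore] -/
theorem laplacian_comp_affine {Φ : E3 → ℝ} (hΦ : ContDiff ℝ 2 Φ) (A : ℝ) (v₀ y : E3) :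
    (Δ (fun y => Φ (A • y + v₀))) y = A ^ 2 * (Δ Φ) (A • y + v₀) := by
  have hΦS : ContDiff ℝ 2 fun y : E3 => Φ (A • y + v₀) := hΦ.comp ((contDiff_const_smul A).add contDiff_const)
  rw [InnerProductSpace.laplacian_eq_iteratedFDeriv_orthonormalBasis (fun y => Φ (A • y + v₀)) (EuclideanSpace.basisFun (Fin 3) ℝ),
    InnerProductSpace.laplacian_eq_iteratedFDeriv_orthonormalBasis Φ (EuclideanSpace.basisFun (Fin 3) ℝ), Finset.mul_sum]
  refine Finset.sum_congr rfl fun i _ => ?_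
  set b := EuclideanSpace.basisFun (Fin 3) ℝ i with hb
  have hd2S : Differentiable ℝ (fderiv ℝ fun y : E3 => Φ (A • y + v₀)) :=
    (hΦS.fderiv_right (m := 1) (by norm_num)).differentiable one_ne_zero
  have hd2 : Differentiable ℝ (fderiv ℝ Φ) := (hΦ.fderiv_right (m := 1) (by norm_num)).differentiable one_ne_zero
  rw [iteratedFDeriv_two_apply, iteratedFDeriv_two_apply]
  simp only [Matrix.cons_val_zero, Matrix.cons_val_one]
  -- express the pure second derivatives as derivatives of `y ↦ D f (y) b` along `b`
  have e1 : fderiv ℝ (fderiv ℝ fun y : E3 => Φ (A • y + v₀)) y b b =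
      fderiv ℝ (fun y => fderiv ℝ (fun y : E3 => Φ (A • y + v₀)) y b) y b := by
    rw [fderiv_clm_apply (hd2S y) (differentiableAt_const _), fderiv_const_apply]
    simp
  have e2 : fderiv ℝ (fderiv ℝ Φ) (A • y + v₀) b b = fderiv ℝ (fun z => fderiv ℝ Φ z b) (A • y + v₀) b := by
    rw [fderiv_clm_apply (hd2 _) (differentiableAt_const _), fderiv_const_apply]
    simp
  rw [e1, e2, fderiv_fderiv_comp_smul_add_apply hΦ A v₀ y b, smul_eq_mul]

end Affine

end Literature.Analysis.FunctionSpaces
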